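import Literature.MathematicalPhysics.QuantumLattice.FermionEmbedLocality
import Literature.MathematicalPhysics.QuantumLattice.HubbardFermionInteractionLocalHamiltonian
import Literature.MathematicalPhysics.QuantumLattice.InfVolFermionStateHubbardEnergy
import HarnessLib

/-!
# The Hubbard torus Hamiltonian near an embedded region: `H_L = Γ(H_{Λ'}) + (far terms)`

Topic `Literature/MathematicalPhysics/QuantumLattice`; namespace
`Literature.MathematicalPhysics.QuantumLattice` (the file path). Pull a finite region `Λ' ⊆ ℤ^d`
back into the fermionic torus `(ℤ/L)^d` by `x ↦ x mod L` (`PolySite.toTorusEmb`, injective on the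
`1`-neighbourhood of `Λ'`). Then the Hubbard Hamiltonian of the torus splits as
`hubbardTorus d L t U = Γ(H_{Λ'}) + R`, where `H_{Λ'}` is the free-boundary Hubbard Hamiltonian of
`Λ'` (`localHamiltonian`, `= hamiltonian (polyGraph Λ')`) and the remainder `R` — the bonds and
sites of the torus not inside the image of `Λ'` — is an EVEN operator supported on the orbitals
over the complement of the image of every `Λ ⊆ Λ'` whose lattice neighbours all lie in `Λ'`
(`hubbardTorus_sub_fermionEmbed_localHamiltonian_mem_carEvenSubalgebra`). By graded locality it
commutes with every embedded observable of `Λ`, so the commutator of the torus Hamiltonian with an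
embedded local observable is the embedded commutator with the local Hamiltonian
(`hubbardTorus_commutator_fermionEmbed`) — the finite-volume form of
`δ(A) = i[H_{Λ'}, A]`, Bratteli–Robinson II Thm. 6.2.4 / Araki–Moriya §6, on the torus.
No definition, no named fact.
-/

noncomputable section

namespace Literature.MathematicalPhysics.QuantumLattice

open Matrix Finset HubbardWave0 Literature.Probability.LatticeModels

variable {d : ℕ}

/-! ### Sites of `ℤ^d` in the torus -/

/-- `x + v ∈ thicken Λ 1` for `x ∈ Λ` and `v ∈ [-1,1]^d = thicken {0} 1`. [folklore] -/
theorem add_mem_thicken_one {Λ : Finset (Site d)} {x v : Site d} (hx : x ∈ Λ)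
    (hv : v ∈ thicken ({0} : Finset (Site d)) 1) : x + v ∈ thicken Λ 1 := by
  rw [thicken, singleton_biUnion, mem_image] at hv
  obtain ⟨w, hw, rfl⟩ := hv
  rw [thicken, mem_biUnion]
  exact ⟨x, hx, mem_image.2 ⟨w, hw, by rw [zero_add]⟩⟩

/-- `x + e_i ∈ thicken Λ 1` for `x ∈ Λ`. [folklore] -/
theorem add_unitVec_mem_thicken_one {Λ : Finset (Site d)} {x : Site d} (hx : x ∈ Λ) (i : Fin d) :
    x + unitVec i ∈ thicken Λ 1 :=
  add_mem_thicken_one hx (unitVec_mem_thicken_one i)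

/-- `x - e_i ∈ thicken Λ 1` for `x ∈ Λ`. [folklore] -/
theorem sub_unitVec_mem_thicken_one {Λ : Finset (Site d)} {x : Site d} (hx : x ∈ Λ) (i : Fin d) :
    x - unitVec i ∈ thicken Λ 1 := by
  rw [sub_eq_add_neg]
  exact add_mem_thicken_one hx (neg_unitVec_mem_thicken_one i)

section Torus

variable (L : ℕ) [NeZero L]

/-- The torus site of `x ∈ Λ` under the pull-back embedding is `x mod L`. [folklore] -/
theorem PolySite.toTorusEmb_pt {Λ : Finset (Site d)} (h : Set.InjOn (Torus.proj (d := d) L) ↑Λ)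
    (x : Site d) (hx : x ∈ Λ) :
    PolySite.toTorusEmb L h (PolySite.pt x hx) = FermionTorus.ofTorusSite (Torus.proj L x) := rfl

/-- `x ↦ (x mod L : FermionTorus)` is injective where `x ↦ x mod L` is. [folklore] -/
theorem injOn_ofTorusSite_proj {S : Finset (Site d)} (h : Set.InjOn (Torus.proj (d := d) L) ↑S) :
    Set.InjOn (fun x : Site d => FermionTorus.ofTorusSite (Torus.proj L x)) ↑S := fun x hx y hy hxy =>
  h hx hy (by simpa using congrArg FermionTorus.toTorusSite hxy)

/-- **Adjacency is preserved and reflected by the pull-back**: for `x, y ∈ Λ'` and `x ↦ x mod L`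
injective on `thicken Λ' 1`, the torus sites `x mod L`, `y mod L` are nearest neighbours on the
torus iff `x, y` are nearest neighbours in `ℤ^d`. [cite: FriedliVelenik2017, §3.1] -/
theorem fermionTorusGraph_adj_ofTorusSite_proj_iff {Λ' : Finset (Site d)}
    (hInj : Set.InjOn (Torus.proj (d := d) L) ↑(thicken Λ' 1)) {x y : Site d} (hx : x ∈ Λ') (hy : y ∈ Λ') :
    (fermionTorusGraph d L).Adj (FermionTorus.ofTorusSite (Torus.proj L x)) (FermionTorus.ofTorusSite (Torus.proj L y)) ↔
      (zdGraph d).Adj x y := by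
  -- `x ↦ x mod L` is additive (`Literature.Probability.LatticeModels.torusProj_add`, restated locally to
  -- keep the import closure small)
  have proj_add : ∀ x y : Site d, Torus.proj L (x + y) = Torus.proj L x + Torus.proj L y := fun x y => by
    funext i; simp [Torus.proj]
  rw [fermionTorusGraph_adj, FermionTorus.toTorusSite_ofTorusSite, FermionTorus.toTorusSite_ofTorusSite,
    torusGraph_adj_iff, zdGraph_adj_iff]
  have hx' : x ∈ (thicken Λ' 1 : Set (Site d)) := subset_thicken Λ' 1 hx
  have hy' : y ∈ (thicken Λ' 1 : Set (Site d)) := subset_thicken Λ' 1 hy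
  constructor
  · rintro ⟨-, ⟨i, hi⟩ | ⟨i, hi⟩⟩
    · refine ⟨i, Or.inl (hInj hy' (add_unitVec_mem_thicken_one hx i) ?_)⟩
      rw [proj_add, proj_unitVec, ← hi]
    · refine ⟨i, Or.inr (hInj hx' (add_unitVec_mem_thicken_one hy i) ?_)⟩
      rw [proj_add, proj_unitVec, ← hi]
  · rintro ⟨i, hi | hi⟩
    · refine ⟨fun h => self_ne_add_unitVec x i (hInj hx' (add_unitVec_mem_thicken_one hx i) ?_) , Or.inl ⟨i, ?_⟩⟩
      · rw [← hi]; exact h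
      · rw [hi, proj_add, proj_unitVec]
    · refine ⟨fun h => self_ne_add_unitVec y i (hInj hy' (add_unitVec_mem_thicken_one hy i) ?_), Or.inr ⟨i, ?_⟩⟩
      · rw [← hi]; exact h.symm
      · rw [hi, proj_add, proj_unitVec]

/-- **A torus bond touching the image of `Λ` lies inside the image of `Λ'`** when every lattice
neighbour of `Λ` is in `Λ'`: if `a = x mod L` with `x ∈ Λ` and `b` is a torus neighbour of `a`, then
`b = y mod L` for some `y ∈ Λ'`. [cite: FriedliVelenik2017, §3.1] -/
theorem mem_image_of_fermionTorusGraph_adj {Λ Λ' : Finset (Site d)}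
    (hclosed : ∀ x ∈ Λ, ∀ i : Fin d, x + unitVec i ∈ Λ' ∧ x - unitVec i ∈ Λ') {x : Site d} (hx : x ∈ Λ)
    {b : FermionTorus d L} (hab : (fermionTorusGraph d L).Adj (FermionTorus.ofTorusSite (Torus.proj L x)) b) :
    b ∈ Λ'.image fun y => FermionTorus.ofTorusSite (Torus.proj L y) := by
  have proj_add : ∀ x y : Site d, Torus.proj L (x + y) = Torus.proj L x + Torus.proj L y := fun x y => by
    funext i; simp [Torus.proj]
  have proj_sub : ∀ x y : Site d, Torus.proj L (x - y) = Torus.proj L x - Torus.proj L y := fun x y => by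
    funext i; simp [Torus.proj]
  rw [fermionTorusGraph_adj, FermionTorus.toTorusSite_ofTorusSite, torusGraph_adj_iff] at hab
  obtain ⟨-, ⟨i, hi⟩ | ⟨i, hi⟩⟩ := hab
  · refine mem_image.2 ⟨x + unitVec i, (hclosed x hx i).1, ?_⟩
    rw [proj_add, proj_unitVec, ← hi, FermionTorus.ofTorusSite_toTorusSite]
  · refine mem_image.2 ⟨x - unitVec i, (hclosed x hx i).2, ?_⟩
    rw [proj_sub, proj_unitVec, hi, add_sub_cancel_right, FermionTorus.ofTorusSite_toTorusSite]

end Torus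

/-! ### The decomposition of the torus Hamiltonian -/

section Decomposition

variable (L : ℕ) [NeZero L] (t U : ℝ)

/-- **The embedded local Hamiltonian, expanded**: `Γ(H_{Λ'})` is the Hubbard Hamiltonian of the
image bonds and sites, `-t Σ_{x∼y ∈ Λ'} Σ_σ c†_{x mod L,σ} c_{y mod L,σ} + U Σ_{x∈Λ'} n n`.
[cite: arXiv9311033, §2] -/
theorem fermionEmbed_toTorusEmb_localHamiltonian {Λ' : Finset (Site d)}
    (h : Set.InjOn (Torus.proj (d := d) L) ↑Λ') :
    fermionEmbed (PolySite.toTorusEmb L h) ((hubbardFermionInteraction d t U).localHamiltonian Λ') =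
      -(t : ℂ) • ∑ x ∈ Λ', ∑ y ∈ Λ', (if (zdGraph d).Adj x y then
          ∑ σ : Fin 2, creation (orb (FermionTorus.ofTorusSite (Torus.proj L x)) σ) *
            annihilation (orb (FermionTorus.ofTorusSite (Torus.proj L y)) σ) else 0) +
        (U : ℂ) • ∑ x ∈ Λ', numberOp (FermionTorus.ofTorusSite (Torus.proj L x)) 0 *
          numberOp (FermionTorus.ofTorusSite (Torus.proj L x)) 1 := by
  -- sums over `PolySite Λ'` as sums over `Λ'`
  let e : PolySite Λ' ≃ {x // x ∈ Λ'} :=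
    ⟨fun a => ⟨ofLex a.1, PolySite.ofLex_mem a⟩, fun x => PolySite.pt x.1 x.2, fun a => PolySite.pt_ofLex a,
      fun x => Subtype.ext rfl⟩
  have hsum : ∀ (f : PolySite Λ' → Matrix (Finset (Orb (FermionTorus d L))) (Finset (Orb (FermionTorus d L))) ℂ)
      (g : Site d → Matrix (Finset (Orb (FermionTorus d L))) (Finset (Orb (FermionTorus d L))) ℂ),
      (∀ (x : Site d) (hx : x ∈ Λ'), f (PolySite.pt x hx) = g x) → ∑ a, f a = ∑ x ∈ Λ', g x := by
    intro f g hfg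
    rw [← Finset.sum_attach Λ' g, ← Finset.univ_eq_attach]
    exact Fintype.sum_equiv e _ _ fun a => by
      rw [← hfg (e a).1 (e a).2, show PolySite.pt (e a).1 (e a).2 = e.symm (e a) from rfl, Equiv.symm_apply_apply]
  rw [hubbardFermionInteraction_localHamiltonian, hamiltonian, fermionEmbed_add, fermionEmbed_smul, fermionEmbed_smul,
    fermionEmbed_sum, fermionEmbed_sum]
  congr 2
  · refine hsum _ _ fun x hx => ?_
    rw [fermionEmbed_sum]
    refine hsum _ _ fun y hy => ?_
    by_cases hxy : (zdGraph d).Adj x y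
    · rw [if_pos hxy, fermionEmbed_sum]
      refine Finset.sum_congr rfl fun σ _ => ?_
      rw [if_pos ((polyGraph_adj _ _).2 hxy), fermionEmbed_mul, fermionEmbed_creation, fermionEmbed_annihilation,
        PolySite.toTorusEmb_pt, PolySite.toTorusEmb_pt]
    · rw [if_neg hxy, Finset.sum_eq_zero fun σ _ => ?_, fermionEmbed_zero]
      exact if_neg fun h' => hxy ((polyGraph_adj _ _).1 h')
  · refine hsum _ _ fun x hx => ?_
    rw [fermionEmbed_mul, fermionEmbed_numberOp, fermionEmbed_numberOp, PolySite.toTorusEmb_pt]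

/-- **`H_L = Γ(H_{Λ'}) + far terms`**: for `x ↦ x mod L` injective on `thicken Λ' 1`, the Hubbard
Hamiltonian of the torus is the embedded free-boundary Hamiltonian of `Λ'` plus the hopping terms
of the torus bonds not inside the image `I'` of `Λ'` and the repulsion at the sites outside `I'`.
[cite: BratteliRobinsonII1997, §6.2.1 (H_Λ' = H_Λ + W)] -/
theorem hubbardTorus_eq_fermionEmbed_localHamiltonian_add {Λ' : Finset (Site d)}
    (hInj : Set.InjOn (Torus.proj (d := d) L) ↑(thicken Λ' 1)) :
    hubbardTorus d L t U =
      fermionEmbed (PolySite.toTorusEmb L (hInj.mono (by exact_mod_cast subset_thicken Λ' 1)))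
          ((hubbardFermionInteraction d t U).localHamiltonian Λ') +
        (-(t : ℂ) • ∑ a : FermionTorus d L, ∑ b : FermionTorus d L,
            (if ¬(a ∈ Λ'.image (fun x => FermionTorus.ofTorusSite (Torus.proj L x)) ∧
                b ∈ Λ'.image (fun x => FermionTorus.ofTorusSite (Torus.proj L x))) then
              ∑ σ : Fin 2, (if (fermionTorusGraph d L).Adj a b then creation (orb a σ) * annihilation (orb b σ) else 0)
            else 0) +
          (U : ℂ) • ∑ a ∈ (Λ'.image (fun x => FermionTorus.ofTorusSite (Torus.proj L x)))ᶜ,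
            numberOp a 0 * numberOp a 1) := by
  have hInj' : Set.InjOn (Torus.proj (d := d) L) ↑Λ' := hInj.mono (by exact_mod_cast subset_thicken Λ' 1)
  have hι : Set.InjOn (fun x : Site d => FermionTorus.ofTorusSite (Torus.proj L x)) ↑Λ' :=
    injOn_ofTorusSite_proj L hInj'
  rw [fermionEmbed_toTorusEmb_localHamiltonian, hubbardTorus, hamiltonian]
  -- the on-site part
  have hsite : ∑ a : FermionTorus d L, numberOp a 0 * numberOp a 1 =
      ∑ x ∈ Λ', numberOp (FermionTorus.ofTorusSite (Torus.proj L x)) 0 *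
          numberOp (FermionTorus.ofTorusSite (Torus.proj L x)) 1 +
        ∑ a ∈ (Λ'.image (fun x => FermionTorus.ofTorusSite (Torus.proj L x)))ᶜ, numberOp a 0 * numberOp a 1 := by
    rw [← Finset.sum_add_sum_compl (Λ'.image fun x => FermionTorus.ofTorusSite (Torus.proj L x)),
      Finset.sum_image hι]
  -- the hopping part: split each term according to whether the bond lies in the image of `Λ'`
  have hsplit : ∀ a b : FermionTorus d L,
      (∑ σ : Fin 2, (if (fermionTorusGraph d L).Adj a b then creation (orb a σ) * annihilation (orb b σ) else 0)) =
        (if a ∈ Λ'.image (fun x => FermionTorus.ofTorusSite (Torus.proj L x)) ∧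
            b ∈ Λ'.image (fun x => FermionTorus.ofTorusSite (Torus.proj L x)) then
          ∑ σ : Fin 2, (if (fermionTorusGraph d L).Adj a b then creation (orb a σ) * annihilation (orb b σ) else 0)
          else 0) +
        (if ¬(a ∈ Λ'.image (fun x => FermionTorus.ofTorusSite (Torus.proj L x)) ∧
            b ∈ Λ'.image (fun x => FermionTorus.ofTorusSite (Torus.proj L x))) then
          ∑ σ : Fin 2, (if (fermionTorusGraph d L).Adj a b then creation (orb a σ) * annihilation (orb b σ) else 0)
          else 0) := by
    intro a b
    by_cases hab : a ∈ Λ'.image (fun x => FermionTorus.ofTorusSite (Torus.proj L x)) ∧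
        b ∈ Λ'.image (fun x => FermionTorus.ofTorusSite (Torus.proj L x))
    · rw [if_pos hab, if_neg (not_not.2 hab), add_zero]
    · rw [if_neg hab, if_pos hab, zero_add]
  -- the bonds inside the image are the images of the bonds of `Λ'`
  have hin : ∑ a : FermionTorus d L, ∑ b : FermionTorus d L,
      (if a ∈ Λ'.image (fun x => FermionTorus.ofTorusSite (Torus.proj L x)) ∧
          b ∈ Λ'.image (fun x => FermionTorus.ofTorusSite (Torus.proj L x)) then
        ∑ σ : Fin 2, (if (fermionTorusGraph d L).Adj a b then creation (orb a σ) * annihilation (orb b σ) else 0)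
        else 0) =
      ∑ x ∈ Λ', ∑ y ∈ Λ', (if (zdGraph d).Adj x y then
          ∑ σ : Fin 2, creation (orb (FermionTorus.ofTorusSite (Torus.proj L x)) σ) *
            annihilation (orb (FermionTorus.ofTorusSite (Torus.proj L y)) σ) else 0) := by
    calc ∑ a : FermionTorus d L, ∑ b : FermionTorus d L,
          (if a ∈ Λ'.image (fun x => FermionTorus.ofTorusSite (Torus.proj L x)) ∧
              b ∈ Λ'.image (fun x => FermionTorus.ofTorusSite (Torus.proj L x)) then
            ∑ σ : Fin 2, (if (fermionTorusGraph d L).Adj a b then creation (orb a σ) * annihilation (orb b σ) else 0)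
            else 0)
        = ∑ a : FermionTorus d L, (if a ∈ Λ'.image (fun x => FermionTorus.ofTorusSite (Torus.proj L x)) then
            ∑ b ∈ Λ'.image (fun x => FermionTorus.ofTorusSite (Torus.proj L x)),
              ∑ σ : Fin 2, (if (fermionTorusGraph d L).Adj a b then creation (orb a σ) * annihilation (orb b σ) else 0)
            else 0) := by
          refine Finset.sum_congr rfl fun a _ => ?_
          by_cases ha : a ∈ Λ'.image (fun x => FermionTorus.ofTorusSite (Torus.proj L x))
          · simp only [ha, true_and, if_true]
            rw [Finset.sum_ite_mem, Finset.univ_inter]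
          · simp only [ha, false_and, if_false, Finset.sum_const_zero]
      _ = ∑ a ∈ Λ'.image (fun x => FermionTorus.ofTorusSite (Torus.proj L x)),
            ∑ b ∈ Λ'.image (fun x => FermionTorus.ofTorusSite (Torus.proj L x)),
              ∑ σ : Fin 2, (if (fermionTorusGraph d L).Adj a b then creation (orb a σ) * annihilation (orb b σ) else 0) := by
          rw [Finset.sum_ite_mem, Finset.univ_inter]
      _ = ∑ x ∈ Λ', ∑ y ∈ Λ', ∑ σ : Fin 2,
            (if (fermionTorusGraph d L).Adj (FermionTorus.ofTorusSite (Torus.proj L x))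
                (FermionTorus.ofTorusSite (Torus.proj L y)) then
              creation (orb (FermionTorus.ofTorusSite (Torus.proj L x)) σ) *
                annihilation (orb (FermionTorus.ofTorusSite (Torus.proj L y)) σ) else 0) := by
          rw [Finset.sum_image hι]
          exact Finset.sum_congr rfl fun x _ => Finset.sum_image hι
      _ = _ := by
          refine Finset.sum_congr rfl fun x hx => Finset.sum_congr rfl fun y hy => ?_
          by_cases hxy : (zdGraph d).Adj x y
          · rw [if_pos hxy]
            exact Finset.sum_congr rfl fun σ _ =>
              if_pos ((fermionTorusGraph_adj_ofTorusSite_proj_iff L hInj hx hy).2 hxy)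
          · rw [if_neg hxy]
            exact Finset.sum_eq_zero fun σ _ =>
              if_neg fun h' => hxy ((fermionTorusGraph_adj_ofTorusSite_proj_iff L hInj hx hy).1 h')
  have hhop : ∑ a : FermionTorus d L, ∑ b : FermionTorus d L, ∑ σ : Fin 2,
        (if (fermionTorusGraph d L).Adj a b then creation (orb a σ) * annihilation (orb b σ) else 0) =
      ∑ x ∈ Λ', ∑ y ∈ Λ', (if (zdGraph d).Adj x y then
          ∑ σ : Fin 2, creation (orb (FermionTorus.ofTorusSite (Torus.proj L x)) σ) *
            annihilation (orb (FermionTorus.ofTorusSite (Torus.proj L y)) σ) else 0) +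
        ∑ a : FermionTorus d L, ∑ b : FermionTorus d L,
            (if ¬(a ∈ Λ'.image (fun x => FermionTorus.ofTorusSite (Torus.proj L x)) ∧
                b ∈ Λ'.image (fun x => FermionTorus.ofTorusSite (Torus.proj L x))) then
              ∑ σ : Fin 2, (if (fermionTorusGraph d L).Adj a b then creation (orb a σ) * annihilation (orb b σ) else 0)
            else 0) := by
    rw [← hin, ← Finset.sum_add_distrib]
    refine Finset.sum_congr rfl fun a _ => ?_
    rw [← Finset.sum_add_distrib]
    exact Finset.sum_congr rfl fun b _ => hsplit a b
  rw [hhop, hsite, smul_add, smul_add]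
  abel

/-- A torus bond touching the image of `Λ ⊆ Λ'` lies inside the image of `Λ'`, when every lattice
neighbour of a site of `Λ` is in `Λ'`. [cite: FriedliVelenik2017, §3.1] -/
theorem mem_image_and_mem_image_of_adj {Λ Λ' : Finset (Site d)} (hΛ : Λ ⊆ Λ')
    (hclosed : ∀ x ∈ Λ, ∀ i : Fin d, x + unitVec i ∈ Λ' ∧ x - unitVec i ∈ Λ') {c c' : FermionTorus d L}
    (hcc' : (fermionTorusGraph d L).Adj c c') (hc : c ∈ Λ.image fun x => FermionTorus.ofTorusSite (Torus.proj L x)) :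
    c ∈ Λ'.image (fun x => FermionTorus.ofTorusSite (Torus.proj L x)) ∧
      c' ∈ Λ'.image (fun x => FermionTorus.ofTorusSite (Torus.proj L x)) := by
  obtain ⟨x, hx, rfl⟩ := Finset.mem_image.1 hc
  exact ⟨Finset.mem_image.2 ⟨x, hΛ hx, rfl⟩, mem_image_of_fermionTorusGraph_adj L hclosed hx hcc'⟩

omit [NeZero L] in
/-- The hopping term of a torus bond avoiding the image of `Λ` is even and supported away from it.
[cite: BratteliRobinsonII1997, §5.2.2] -/
theorem sum_ite_adj_mem_carEvenSubalgebra [NeZero L] {I : Finset (FermionTorus d L)} {a b : FermionTorus d L}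
    (h : (fermionTorusGraph d L).Adj a b → a ∉ I ∧ b ∉ I) :
    (∑ σ : Fin 2, (if (fermionTorusGraph d L).Adj a b then creation (orb a σ) * annihilation (orb b σ) else 0)) ∈
      carEvenSubalgebra (orbs I)ᶜ := by
  by_cases hadj : (fermionTorusGraph d L).Adj a b
  · refine sum_mem fun σ _ => ?_
    rw [if_pos hadj]
    exact creation_mul_annihilation_mem_carEvenSubalgebra
      (Finset.mem_compl.2 fun h' => (h hadj).1 (orb_mem_orbs.1 h'))
      (Finset.mem_compl.2 fun h' => (h hadj).2 (orb_mem_orbs.1 h'))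
  · rw [Finset.sum_eq_zero fun σ _ => if_neg hadj]
    exact zero_mem _

/-- **The far hopping terms are even and supported away from the image of `Λ`.**
[cite: BratteliRobinsonII1997, §5.2.2] -/
theorem far_hopping_mem_carEvenSubalgebra {Λ Λ' : Finset (Site d)} (hΛ : Λ ⊆ Λ')
    (hclosed : ∀ x ∈ Λ, ∀ i : Fin d, x + unitVec i ∈ Λ' ∧ x - unitVec i ∈ Λ') :
    (∑ a : FermionTorus d L, ∑ b : FermionTorus d L,
        (if ¬(a ∈ Λ'.image (fun x => FermionTorus.ofTorusSite (Torus.proj L x)) ∧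
            b ∈ Λ'.image (fun x => FermionTorus.ofTorusSite (Torus.proj L x))) then
          ∑ σ : Fin 2, (if (fermionTorusGraph d L).Adj a b then creation (orb a σ) * annihilation (orb b σ) else 0)
        else 0)) ∈
      carEvenSubalgebra (orbs (Λ.image fun x => FermionTorus.ofTorusSite (Torus.proj L x)))ᶜ := by
  refine sum_mem fun a _ => sum_mem fun b _ => ?_
  by_cases hab : ¬(a ∈ Λ'.image (fun x => FermionTorus.ofTorusSite (Torus.proj L x)) ∧
      b ∈ Λ'.image (fun x => FermionTorus.ofTorusSite (Torus.proj L x)))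
  · rw [if_pos hab]
    refine sum_ite_adj_mem_carEvenSubalgebra L fun hadj => ⟨fun ha => hab ?_, fun hb => hab ?_⟩
    · exact mem_image_and_mem_image_of_adj L hΛ hclosed hadj ha
    · exact (mem_image_and_mem_image_of_adj L hΛ hclosed hadj.symm hb).symm
  · rw [if_neg hab]
    exact zero_mem _

/-- **The far repulsion terms are even and supported away from the image of `Λ`.**
[cite: BratteliRobinsonII1997, §5.2.2] -/
theorem far_onSite_mem_carEvenSubalgebra {Λ Λ' : Finset (Site d)} (hΛ : Λ ⊆ Λ') :
    (∑ a ∈ (Λ'.image (fun x => FermionTorus.ofTorusSite (Torus.proj L x)))ᶜ, numberOp a 0 * numberOp a 1) ∈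
      carEvenSubalgebra (orbs (Λ.image fun x => FermionTorus.ofTorusSite (Torus.proj L x)))ᶜ := by
  refine sum_mem fun a ha => numberOp_mul_numberOp_mem_carEvenSubalgebra fun σ => ?_
  refine Finset.mem_compl.2 fun h => Finset.mem_compl.1 ha ?_
  exact Finset.image_subset_image hΛ (orb_mem_orbs.1 h)

/-- **The far terms are even and supported away from the image of `Λ`**: if `Λ ⊆ Λ'` and every
lattice neighbour of a site of `Λ` lies in `Λ'`, then the torus bonds not inside the image of `Λ'`
and the sites outside it avoid the image of `Λ`, so the far part of the decomposition belongs to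
the even CAR subalgebra of the orbitals over the complement of the image of `Λ`.
[cite: BratteliRobinsonII1997, §5.2.2] -/
theorem far_mem_carEvenSubalgebra {Λ Λ' : Finset (Site d)} (hΛ : Λ ⊆ Λ')
    (hclosed : ∀ x ∈ Λ, ∀ i : Fin d, x + unitVec i ∈ Λ' ∧ x - unitVec i ∈ Λ') :
    (-(t : ℂ) • ∑ a : FermionTorus d L, ∑ b : FermionTorus d L,
        (if ¬(a ∈ Λ'.image (fun x => FermionTorus.ofTorusSite (Torus.proj L x)) ∧
            b ∈ Λ'.image (fun x => FermionTorus.ofTorusSite (Torus.proj L x))) then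
          ∑ σ : Fin 2, (if (fermionTorusGraph d L).Adj a b then creation (orb a σ) * annihilation (orb b σ) else 0)
        else 0) +
      (U : ℂ) • ∑ a ∈ (Λ'.image (fun x => FermionTorus.ofTorusSite (Torus.proj L x)))ᶜ,
        numberOp a 0 * numberOp a 1) ∈
      carEvenSubalgebra (orbs (Λ.image fun x => FermionTorus.ofTorusSite (Torus.proj L x)))ᶜ :=
  add_mem (SMulMemClass.smul_mem _ (far_hopping_mem_carEvenSubalgebra L hΛ hclosed))
    (SMulMemClass.smul_mem _ (far_onSite_mem_carEvenSubalgebra L hΛ))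

/-- **`H_L - Γ(H_{Λ'})` is even and far from `Λ`**: under the hypotheses above, the difference of
the torus Hamiltonian and the embedded local Hamiltonian of `Λ' ⊇ Λ` lies in the even CAR
subalgebra of the orbitals away from the image of `Λ`. [cite: BratteliRobinsonII1997, §6.2.1 and §5.2.2] -/
theorem hubbardTorus_sub_fermionEmbed_localHamiltonian_mem_carEvenSubalgebra {Λ Λ' : Finset (Site d)}
    (hΛ : Λ ⊆ Λ') (hclosed : ∀ x ∈ Λ, ∀ i : Fin d, x + unitVec i ∈ Λ' ∧ x - unitVec i ∈ Λ')
    (hInj : Set.InjOn (Torus.proj (d := d) L) ↑(thicken Λ' 1)) :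
    hubbardTorus d L t U -
        fermionEmbed (PolySite.toTorusEmb L (hInj.mono (by exact_mod_cast subset_thicken Λ' 1)))
          ((hubbardFermionInteraction d t U).localHamiltonian Λ') ∈
      carEvenSubalgebra (orbs (Λ.image fun x => FermionTorus.ofTorusSite (Torus.proj L x)))ᶜ := by
  rw [hubbardTorus_eq_fermionEmbed_localHamiltonian_add L t U hInj, add_sub_cancel_left]
  exact far_mem_carEvenSubalgebra L t U hΛ hclosed

/-- The embedded observables of `Λ` live on the orbitals over the image of `Λ`. [folklore] -/
theorem orbs_map_incl_trans_toTorusEmb_subset {Λ Λ' : Finset (Site d)} (hΛ : Λ ⊆ Λ')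
    (h : Set.InjOn (Torus.proj (d := d) L) ↑Λ') :
    orbs ((Finset.univ : Finset (PolySite Λ)).map ((PolySite.incl hΛ).trans (PolySite.toTorusEmb L h))) ⊆
      orbs (Λ.image fun x => FermionTorus.ofTorusSite (Torus.proj L x)) := by
  intro i hi
  rw [mem_orbs] at hi ⊢
  obtain ⟨p, -, hp⟩ := Finset.mem_map.1 hi
  refine Finset.mem_image.2 ⟨ofLex p.1, PolySite.ofLex_mem p, ?_⟩
  rw [← hp, Function.Embedding.trans_apply, PolySite.toTorusEmb_apply, PolySite.coe_incl]

/-- **Graded locality on the torus**: `H_L - Γ(H_{Λ'})` commutes with every embedded observable of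
`Λ`. [cite: BratteliRobinsonII1997, §5.2.2] -/
theorem commute_hubbardTorus_sub_fermionEmbed_localHamiltonian {Λ Λ' : Finset (Site d)}
    (hΛ : Λ ⊆ Λ') (hclosed : ∀ x ∈ Λ, ∀ i : Fin d, x + unitVec i ∈ Λ' ∧ x - unitVec i ∈ Λ')
    (hInj : Set.InjOn (Torus.proj (d := d) L) ↑(thicken Λ' 1)) (A : FermionOp Λ) :
    Commute (hubbardTorus d L t U -
        fermionEmbed (PolySite.toTorusEmb L (hInj.mono (by exact_mod_cast subset_thicken Λ' 1)))
          ((hubbardFermionInteraction d t U).localHamiltonian Λ'))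
      (fermionEmbed (PolySite.toTorusEmb L (hInj.mono (by exact_mod_cast subset_thicken Λ' 1)))
        (fermionEmbed (PolySite.incl hΛ) A)) := by
  rw [fermionEmbed_fermionEmbed]
  refine commute_of_mem_carEvenSubalgebra
    (hubbardTorus_sub_fermionEmbed_localHamiltonian_mem_carEvenSubalgebra L t U hΛ hclosed hInj)
    (fermionEmbed_mem_carSubalgebra _ A) ?_
  exact disjoint_compl_left_iff.2 (orbs_map_incl_trans_toTorusEmb_subset L hΛ _)

/-- **The commutator with the torus Hamiltonian is the embedded local commutator**: for an observable
`A` of `Λ`, embedded into the torus through `Λ' ⊇ Λ` (`Λ'` containing all lattice neighbours of `Λ`,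
`x ↦ x mod L` injective on `thicken Λ' 1`),
`[H_L, Γ A] = Γ([H_{Λ'}, A])` — the torus form of `δ(A) = i[H_{Λ'}, A]`, Bratteli–Robinson II
Thm. 6.2.4. [cite: BratteliRobinsonII1997, Thm. 6.2.4] -/
theorem hubbardTorus_commutator_fermionEmbed {Λ Λ' : Finset (Site d)}
    (hΛ : Λ ⊆ Λ') (hclosed : ∀ x ∈ Λ, ∀ i : Fin d, x + unitVec i ∈ Λ' ∧ x - unitVec i ∈ Λ')
    (hInj : Set.InjOn (Torus.proj (d := d) L) ↑(thicken Λ' 1)) (A : FermionOp Λ) :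
    hubbardTorus d L t U *
          fermionEmbed (PolySite.toTorusEmb L (hInj.mono (by exact_mod_cast subset_thicken Λ' 1)))
            (fermionEmbed (PolySite.incl hΛ) A) -
        fermionEmbed (PolySite.toTorusEmb L (hInj.mono (by exact_mod_cast subset_thicken Λ' 1)))
            (fermionEmbed (PolySite.incl hΛ) A) * hubbardTorus d L t U =
      fermionEmbed (PolySite.toTorusEmb L (hInj.mono (by exact_mod_cast subset_thicken Λ' 1)))
        ((hubbardFermionInteraction d t U).localHamiltonian Λ' * fermionEmbed (PolySite.incl hΛ) A -
          fermionEmbed (PolySite.incl hΛ) A * (hubbardFermionInteraction d t U).localHamiltonian Λ') := by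
  have hc := commute_hubbardTorus_sub_fermionEmbed_localHamiltonian L t U hΛ hclosed hInj A
  rw [Commute, SemiconjBy, sub_mul, mul_sub, sub_eq_sub_iff_sub_eq_sub] at hc
  rw [fermionEmbed_sub, fermionEmbed_mul, fermionEmbed_mul]
  exact hc

end Decomposition

end Literature.MathematicalPhysics.QuantumLattice

end
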